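import Literature.MathematicalPhysics.QuantumFieldTheory.Balaban1983to89.B5Prop11Lower

/-!
# `BalabanUV.Beta.GAN24.ChainLeibniz` — binder row G-an2-4 ∕ (CONV-C), route R7 «TWO CURRENCIES», step S4 (LEIBNIZ) in the
# DEMOTED currency: local vertex chains `Σ_x Σ_{ijl} c_{ijl}·f(x,i)g(x,j)h(x,l)` and operator-slot entries `f* T g` — exact
# telescoping, «any slot may carry the sup» bounds, fibre-constant transport, rectangular `ℓ²` column tools

NOT IN PRINT; OUR PROOF ATTEMPT (prover part P3 of row G-an2-4, fibre∕strip («Woodbury») lineage, gen 25; CRUX TEAM (2), ruling «YM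
REDIRECT TOWARDS THE SUMMIT», 2026-08-21: «work the best two candidate routes of record»).  HONEST DEPENDENCY (cell records, verbatim):
«continuum YM on T⁴ ⇐ BetaPertH ∧ nine spine estimates (0/9 proved); BetaPertH ⇐ (D1) ∧ (D4) ∧ CAP+tail; G-an2-4 gates asym, D1 and
NE2/3/4.»  HONEST FRAMING (cell contract, verbatim): «discharging `BetaPertH` makes Bałaban's UV stability UNCONDITIONAL — a real
constructive-QFT result; it is NOT the continuum limit and NOT the Clay problem.»  ABSOLUTE RULE: nothing printed is a hypothesis; no
`def … : Prop`, no sorry.  [folklore] finite-dimensional algebra and Cauchy–Schwarz only.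

## What route R7 asks of this file (`HOME/beta/ROUTES-GAN24.md` v6 §2 R7, author gan24-idea-1; PRICING-GAN24 v3.6 §5: KEEP, rank 1)

R7 splits (CONV-C) = [k-uniform DECAY] ∧ [geometric RATE] and proves the RATE half by a LEIBNIZ sum over chains
`⟨ℓ_y, 𝒜₁𝒱₁[h]𝒜₂ ⋯ ℓ′_{y′}⟩` in which «every differenced factor is measured in the WEAKEST currency that still sees a unit-lattice entry»
(S4: «replace one by one every factor … the error is the same graph with a difference of propagators on one line», King 1986 I p. 665;
(ii) NORM DEMOTION: `|entry| ≤ Π(operator norms) × Π(leg ℓ²-norms)`; (P-R7f): the differenced slot is never a bare derivative letter).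
This module is the GENERIC KERNEL of S4 for the two chain shapes that occur at value level (the crux ideation seat's folder sketch
`HOME/b2b-balaban-gan24-idea-1/Sketch_R7.lean` e4a228c4b151a059 — `leibniz₃`, `entry_le_opNorm`, `leibniz_entry` — made tree lemmas, re-proved
here with credit; the sketch was «a leaf only on a CRUX prover's INTERFACE REQUEST», requested and built by this crux seat):

 * §0 the core estimate `‖Σ_x a·b·u·v‖ ≤ B_b·B_u·(√(Σ‖a‖²)·√(Σ‖v‖²))` (two factors in sup, two in `ℓ²`; Cauchy–Schwarz);
 * §1 LOCAL VERTEX CHAINS on a product index `α × κ` (sites × components): `vtx₃ c f g h := Σ_x Σ_{i,j,l} c i j l·(f(x,i)·g(x,j)·h(x,l))`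
   (the value-level SHAPE of a cubic local vertex between two unit-sourced legs — R7 (P-R7a)'s toy column `V0 = ⟨u_y, h u_{y′}⟩`), its
   EXACT three-term telescoping **`vtx₃_leibniz`**, and the DEMOTED bounds **`norm_vtx₃_le_mid ∕ _left ∕ _right`**:
   `‖vtx₃ c f g h‖ ≤ ‖c‖₁·(B·(√(nsq ·)·√(nsq ·)))` with the sup letter `B` on ANY ONE slot and plain `ℓ²` norms (`B5Prop11Lower.nsq`) on the
   other two — in the Leibniz sum the DIFFERENCED column is always taken in `ℓ²` and a NEIGHBOUR in sup: «no sup-norm RATE of any fine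
   leg is needed, only sup BOUNDS» (R7's thesis) is this lemma; **`norm_vtx₃_sub_vtx₃_le`** assembles the three terms;
 * (§2, the four-slot twin `vtx₄` — the SHAPE of AN1 Table T row T1's `ad*_h ad_{h′}` bracket between two legs = four columns — is the
   companion module `GAN24/ChainLeibnizFour`, split off for the 400-line limit;)
 * §3 FIBRE-CONSTANT TRANSPORT **`sum_comp_fst_equiv`**: along `e : α′ ≃ α × β`, `Σ_{x′} F((e x′).1) = |β|·Σ_x F(x)` — the counting identity
   behind the EXACT transport of local vertices under King's isometric staircase `J = L^{−d/2}·(u ∘ par)` (consumer: `GAN24/SoftColumnVertexRate`);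
 * §4 OPERATOR-SLOT ENTRIES (rectangular): **`nsq_mulVec_le_rect`** (`nsq (A v) ≤ ‖A‖²·nsq v` for `A : Matrix m k ℂ`, from Mathlib's
   `ContinuousLinearMap.le_opNorm` under `Matrix.l2_opNorm_def`), `nsq_single_one`, **`nsq_col_le`** (a column of `A` has `nsq ≤ ‖A‖²`),
   **`norm_entry_le`** `‖f*·(T g)‖ ≤ ‖T‖·(√(nsq f)·√(nsq g))`, the exact **`entry_leibniz`**, and **`norm_conjTranspose_mul_apply_le`**
   (`‖(AᴴB) p r‖ ≤ ‖A‖·‖B‖`, Gram-kernel entries between columns).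

NOT HERE: any Bałaban object (the INSTANCE on NE2-P1's typed `U = 1` tower is `GAN24/SoftColumnVertexRate`); the decay half (H2); the join
(tree: `CombesThomas.decayCauchy_of_uniformDecays_supRate`, p1's `StencilSlotSupRate`).  NEVER «G-an2-4 closed»; NOT (CONV-C), NOT D1, NOT
BetaPertH, NOT continuum, NOT Clay.  Provenance: prover-b2b-balaban-gan24-p3-g25-0 (unit `b2b-balaban-gan24-p3`, gen 25), 2026-08-21.
-/

noncomputable section

open scoped BigOperators ComplexConjugate Matrix Matrix.Norms.L2Operator
open Finset

namespace Summit.QuantumFields.BalabanUV.Beta.GAN24.ChainLeibniz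

open Literature.MathematicalPhysics.QuantumFieldTheory.Balaban1983to89.B5Prop11Lower (nsq nsq_nonneg norm_star_dotProduct_le)

/-! ## §0 Scalar tools: products of four functions on a finite set, Cauchy–Schwarz with two sup letters -/

section Core

variable {α : Type*} [Fintype α]

/-- `Σ_x ‖u x‖² ≥ 0`. [folklore] -/
theorem sum_norm_sq_nonneg (u : α → ℂ) : 0 ≤ ∑ x, ‖u x‖ ^ 2 := Finset.sum_nonneg fun _ _ => by positivity

/-- the core DEMOTED-CURRENCY estimate: `‖Σ_x a·b·u·v‖ ≤ B_b·B_u·(√(Σ‖a‖²)·√(Σ‖v‖²))` — two factors in sup, two in `ℓ²`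
(triangle inequality + Cauchy–Schwarz `Real.sum_mul_le_sqrt_mul_sqrt`). [folklore] -/
theorem norm_sum_mul₄_le (a b u v : α → ℂ) {Bb Bu : ℝ} (hBb : 0 ≤ Bb) (hBu : 0 ≤ Bu) (hb : ∀ x, ‖b x‖ ≤ Bb)
    (hu : ∀ x, ‖u x‖ ≤ Bu) :
    ‖∑ x, a x * b x * u x * v x‖ ≤ Bb * Bu * (Real.sqrt (∑ x, ‖a x‖ ^ 2) * Real.sqrt (∑ x, ‖v x‖ ^ 2)) := by
  have hpt : ∀ x, ‖a x * b x * u x * v x‖ ≤ Bb * Bu * (‖a x‖ * ‖v x‖) := by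
    intro x
    rw [norm_mul, norm_mul, norm_mul]
    have h1 : ‖b x‖ * ‖u x‖ ≤ Bb * Bu := mul_le_mul (hb x) (hu x) (norm_nonneg _) hBb
    calc ‖a x‖ * ‖b x‖ * ‖u x‖ * ‖v x‖ = (‖b x‖ * ‖u x‖) * (‖a x‖ * ‖v x‖) := by ring
      _ ≤ Bb * Bu * (‖a x‖ * ‖v x‖) := mul_le_mul_of_nonneg_right h1 (mul_nonneg (norm_nonneg _) (norm_nonneg _))
  have hcs : ∑ x, ‖a x‖ * ‖v x‖ ≤ Real.sqrt (∑ x, ‖a x‖ ^ 2) * Real.sqrt (∑ x, ‖v x‖ ^ 2) :=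
    Real.sum_mul_le_sqrt_mul_sqrt _ _ _
  calc ‖∑ x, a x * b x * u x * v x‖ ≤ ∑ x, ‖a x * b x * u x * v x‖ := norm_sum_le _ _
    _ ≤ ∑ x, Bb * Bu * (‖a x‖ * ‖v x‖) := Finset.sum_le_sum fun x _ => hpt x
    _ = Bb * Bu * ∑ x, ‖a x‖ * ‖v x‖ := by rw [Finset.mul_sum]
    _ ≤ Bb * Bu * (Real.sqrt (∑ x, ‖a x‖ ^ 2) * Real.sqrt (∑ x, ‖v x‖ ^ 2)) :=
        mul_le_mul_of_nonneg_left hcs (mul_nonneg hBb hBu)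

/-- three factors: `‖Σ_x a·b·v‖ ≤ B_b·(√(Σ‖a‖²)·√(Σ‖v‖²))` (the middle one in sup). [folklore] -/
theorem norm_sum_mul₃_le (a b v : α → ℂ) {Bb : ℝ} (hBb : 0 ≤ Bb) (hb : ∀ x, ‖b x‖ ≤ Bb) :
    ‖∑ x, a x * b x * v x‖ ≤ Bb * (Real.sqrt (∑ x, ‖a x‖ ^ 2) * Real.sqrt (∑ x, ‖v x‖ ^ 2)) := by
  have h := norm_sum_mul₄_le a b (fun _ => (1 : ℂ)) v hBb zero_le_one hb (fun _ => le_of_eq norm_one)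
  simp only [mul_one] at h
  exact h

end Core

/-! ## §1 Local vertex chains with three slots on a product index (sites × components) -/

section Vertex

variable {α κ : Type*} [Fintype α] [Fintype κ]

/-- slice of a field on `α × κ` at a fixed component: `Σ_x ‖f(x,i)‖² ≤ nsq f`. [folklore] -/
theorem sum_norm_sq_slice_le (f : α × κ → ℂ) (i : κ) : ∑ x, ‖f (x, i)‖ ^ 2 ≤ nsq f := by
  rw [nsq, Fintype.sum_prod_type]
  refine Finset.sum_le_sum fun x _ => ?_
  exact Finset.single_le_sum (f := fun j => ‖f (x, j)‖ ^ 2) (fun _ _ => by positivity) (Finset.mem_univ i)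

/-- `√(Σ_x ‖f(x,i)‖²) ≤ √(nsq f)`. [folklore] -/
theorem sqrt_slice_le (f : α × κ → ℂ) (i : κ) : Real.sqrt (∑ x, ‖f (x, i)‖ ^ 2) ≤ Real.sqrt (nsq f) :=
  Real.sqrt_le_sqrt (sum_norm_sq_slice_le f i)

/-- the `ℓ¹` size of a coefficient tensor with three component slots. [folklore] -/
def cnorm₃ (c : κ → κ → κ → ℂ) : ℝ := ∑ i, ∑ j, ∑ l, ‖c i j l‖

omit [Fintype α] in
/-- `0 ≤ ‖c‖₁`. [folklore] -/
theorem cnorm₃_nonneg (c : κ → κ → κ → ℂ) : 0 ≤ cnorm₃ c :=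
  Finset.sum_nonneg fun _ _ => Finset.sum_nonneg fun _ _ => Finset.sum_nonneg fun _ _ => norm_nonneg _

/-- **THE THREE-SLOT LOCAL VERTEX CHAIN** `vtx₃ c f g h = Σ_x Σ_{i,j,l} c i j l·(f(x,i)·g(x,j)·h(x,l))`: a cubic local vertex (coefficient
tensor `c` over components) read on three columns — the value-level shape of «leg · (local vertex in a background column) · leg». [folklore] -/
def vtx₃ (c : κ → κ → κ → ℂ) (f g h : α × κ → ℂ) : ℂ := ∑ x, ∑ i, ∑ j, ∑ l, c i j l * (f (x, i) * g (x, j) * h (x, l))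

/-- **LEIBNIZ (exact)**: `V[f′,g′,h′] − V[f,g,h] = V[f′−f, g′, h′] + V[f, g′−g, h′] + V[f, g, h′−h]` — «replace one by one every factor;
the error is the same graph with a difference on one line». [folklore] -/
theorem vtx₃_leibniz (c : κ → κ → κ → ℂ) (f g h f' g' h' : α × κ → ℂ) :
    vtx₃ c f' g' h' - vtx₃ c f g h = vtx₃ c (f' - f) g' h' + vtx₃ c f (g' - g) h' + vtx₃ c f g (h' - h) := by
  simp only [vtx₃, ← Finset.sum_add_distrib, ← Finset.sum_sub_distrib, Pi.sub_apply]
  refine Finset.sum_congr rfl fun x _ => Finset.sum_congr rfl fun i _ => Finset.sum_congr rfl fun j _ =>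
    Finset.sum_congr rfl fun l _ => ?_
  ring

/-- the component-wise reduction: `‖vtx₃ c f g h‖ ≤ Σ_{ijl} ‖c i j l‖·‖Σ_x f(x,i)g(x,j)h(x,l)‖`. [folklore] -/
theorem norm_vtx₃_le_sum (c : κ → κ → κ → ℂ) (f g h : α × κ → ℂ) :
    ‖vtx₃ c f g h‖ ≤ ∑ i, ∑ j, ∑ l, ‖c i j l‖ * ‖∑ x, f (x, i) * g (x, j) * h (x, l)‖ := by
  have e : vtx₃ c f g h = ∑ i, ∑ j, ∑ l, c i j l * ∑ x, f (x, i) * g (x, j) * h (x, l) := by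
    rw [vtx₃, Finset.sum_comm]
    refine Finset.sum_congr rfl fun i _ => ?_
    rw [Finset.sum_comm]
    refine Finset.sum_congr rfl fun j _ => ?_
    rw [Finset.sum_comm]
    refine Finset.sum_congr rfl fun l _ => ?_
    rw [Finset.mul_sum]
  rw [e]
  refine (norm_sum_le _ _).trans (Finset.sum_le_sum fun i _ => (norm_sum_le _ _).trans (Finset.sum_le_sum fun j _ =>
    (norm_sum_le _ _).trans (Finset.sum_le_sum fun l _ => ?_)))
  rw [norm_mul]

/-- from a uniform bound on the component sums to the `‖c‖₁`-weighted bound. [folklore] -/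
theorem norm_vtx₃_le_of_forall (c : κ → κ → κ → ℂ) (f g h : α × κ → ℂ) {K : ℝ}
    (hK : ∀ i j l, ‖∑ x, f (x, i) * g (x, j) * h (x, l)‖ ≤ K) : ‖vtx₃ c f g h‖ ≤ cnorm₃ c * K := by
  refine (norm_vtx₃_le_sum c f g h).trans ?_
  rw [cnorm₃, Finset.sum_mul]
  refine Finset.sum_le_sum fun i _ => ?_
  rw [Finset.sum_mul]
  refine Finset.sum_le_sum fun j _ => ?_
  rw [Finset.sum_mul]
  exact Finset.sum_le_sum fun l _ => mul_le_mul_of_nonneg_left (hK i j l) (norm_nonneg _)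

/-- **DEMOTED BOUND, sup on the MIDDLE slot**: `‖vtx₃ c f g h‖ ≤ ‖c‖₁·(B·(√(nsq f)·√(nsq h)))`. [folklore] -/
theorem norm_vtx₃_le_mid (c : κ → κ → κ → ℂ) (f g h : α × κ → ℂ) {B : ℝ} (hB : 0 ≤ B) (hg : ∀ z, ‖g z‖ ≤ B) :
    ‖vtx₃ c f g h‖ ≤ cnorm₃ c * (B * (Real.sqrt (nsq f) * Real.sqrt (nsq h))) := by
  refine norm_vtx₃_le_of_forall c f g h fun i j l => ?_
  calc ‖∑ x, f (x, i) * g (x, j) * h (x, l)‖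
      ≤ B * (Real.sqrt (∑ x, ‖f (x, i)‖ ^ 2) * Real.sqrt (∑ x, ‖h (x, l)‖ ^ 2)) :=
        norm_sum_mul₃_le (fun x => f (x, i)) (fun x => g (x, j)) (fun x => h (x, l)) hB fun x => hg (x, j)
    _ ≤ B * (Real.sqrt (nsq f) * Real.sqrt (nsq h)) :=
        mul_le_mul_of_nonneg_left (mul_le_mul (sqrt_slice_le f i) (sqrt_slice_le h l) (Real.sqrt_nonneg _)
          (Real.sqrt_nonneg _)) hB

/-- permutation of the first two slots: `vtx₃ c f g h = vtx₃ c′ g f h` with `c′ j i l = c i j l`. [folklore] -/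
theorem vtx₃_swap₁₂ (c : κ → κ → κ → ℂ) (f g h : α × κ → ℂ) :
    vtx₃ c f g h = vtx₃ (fun j i l => c i j l) g f h := by
  simp only [vtx₃]
  refine Finset.sum_congr rfl fun x _ => ?_
  rw [Finset.sum_comm]
  refine Finset.sum_congr rfl fun j _ => Finset.sum_congr rfl fun i _ => Finset.sum_congr rfl fun l _ => ?_
  ring

/-- permutation of the last two slots: `vtx₃ c f g h = vtx₃ c″ f h g` with `c″ i l j = c i j l`. [folklore] -/
theorem vtx₃_swap₂₃ (c : κ → κ → κ → ℂ) (f g h : α × κ → ℂ) :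
    vtx₃ c f g h = vtx₃ (fun i l j => c i j l) f h g := by
  simp only [vtx₃]
  refine Finset.sum_congr rfl fun x _ => Finset.sum_congr rfl fun i _ => ?_
  rw [Finset.sum_comm]
  refine Finset.sum_congr rfl fun l _ => Finset.sum_congr rfl fun j _ => ?_
  ring

omit [Fintype α] in
/-- `‖c′‖₁ = ‖c‖₁` for the (1,2)-swapped tensor. [folklore] -/
theorem cnorm₃_swap₁₂ (c : κ → κ → κ → ℂ) : cnorm₃ (fun j i l => c i j l) = cnorm₃ c := by
  rw [cnorm₃, cnorm₃, Finset.sum_comm]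

omit [Fintype α] in
/-- `‖c″‖₁ = ‖c‖₁` for the (2,3)-swapped tensor. [folklore] -/
theorem cnorm₃_swap₂₃ (c : κ → κ → κ → ℂ) : cnorm₃ (fun i l j => c i j l) = cnorm₃ c := by
  rw [cnorm₃, cnorm₃]
  refine Finset.sum_congr rfl fun i _ => ?_
  rw [Finset.sum_comm]

/-- **DEMOTED BOUND, sup on the FIRST slot**: `‖vtx₃ c f g h‖ ≤ ‖c‖₁·(B·(√(nsq g)·√(nsq h)))`. [folklore] -/
theorem norm_vtx₃_le_left (c : κ → κ → κ → ℂ) (f g h : α × κ → ℂ) {B : ℝ} (hB : 0 ≤ B) (hf : ∀ z, ‖f z‖ ≤ B) :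
    ‖vtx₃ c f g h‖ ≤ cnorm₃ c * (B * (Real.sqrt (nsq g) * Real.sqrt (nsq h))) := by
  rw [vtx₃_swap₁₂, ← cnorm₃_swap₁₂ c]
  exact norm_vtx₃_le_mid _ g f h hB hf

/-- **DEMOTED BOUND, sup on the LAST slot**: `‖vtx₃ c f g h‖ ≤ ‖c‖₁·(B·(√(nsq f)·√(nsq g)))`. [folklore] -/
theorem norm_vtx₃_le_right (c : κ → κ → κ → ℂ) (f g h : α × κ → ℂ) {B : ℝ} (hB : 0 ≤ B) (hh : ∀ z, ‖h z‖ ≤ B) :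
    ‖vtx₃ c f g h‖ ≤ cnorm₃ c * (B * (Real.sqrt (nsq f) * Real.sqrt (nsq g))) := by
  rw [vtx₃_swap₂₃, ← cnorm₃_swap₂₃ c]
  exact norm_vtx₃_le_mid _ f h g hB hh

/-- `nsq u ≤ t²`, `0 ≤ t` ⟹ `√(nsq u) ≤ t`. [folklore] -/
theorem sqrt_nsq_le_of_sq {ι : Type*} [Fintype ι] {u : ι → ℂ} {t : ℝ} (ht : 0 ≤ t) (hu : nsq u ≤ t ^ 2) :
    Real.sqrt (nsq u) ≤ t :=
  (Real.sqrt_le_sqrt hu).trans (le_of_eq (Real.sqrt_sq ht))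

/-- **R7-S4 FOR THE THREE-SLOT CHAIN**: if the three differenced columns have `ℓ²` size `≤ ε` (`nsq ≤ ε²`), the columns `g`, `h′` have
`ℓ²` size `≤ A`, and the two columns that serve as sup NEIGHBOURS (`g′` for the first term, `f` for the other two) are pointwise `≤ B`,
then `‖V[f′,g′,h′] − V[f,g,h]‖ ≤ 3·‖c‖₁·B·A·ε` — no sup-norm RATE enters, only sup BOUNDS. [folklore] -/
theorem norm_vtx₃_sub_vtx₃_le (c : κ → κ → κ → ℂ) (f g h f' g' h' : α × κ → ℂ) {ε A B : ℝ} (hε : 0 ≤ ε) (hA : 0 ≤ A)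
    (hB : 0 ≤ B)
    (hdf : nsq (f' - f) ≤ ε ^ 2) (hdg : nsq (g' - g) ≤ ε ^ 2) (hdh : nsq (h' - h) ≤ ε ^ 2)
    (hg : nsq g ≤ A ^ 2) (hh' : nsq h' ≤ A ^ 2)
    (hg'sup : ∀ z, ‖g' z‖ ≤ B) (hfsup : ∀ z, ‖f z‖ ≤ B) :
    ‖vtx₃ c f' g' h' - vtx₃ c f g h‖ ≤ 3 * (cnorm₃ c * (B * (A * ε))) := by
  have hc := cnorm₃_nonneg c
  rw [vtx₃_leibniz]
  have t1 : ‖vtx₃ c (f' - f) g' h'‖ ≤ cnorm₃ c * (B * (A * ε)) := by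
    refine (norm_vtx₃_le_mid c _ _ _ hB hg'sup).trans (mul_le_mul_of_nonneg_left (mul_le_mul_of_nonneg_left ?_ hB) hc)
    rw [mul_comm A ε]
    exact mul_le_mul (sqrt_nsq_le_of_sq hε hdf) (sqrt_nsq_le_of_sq hA hh') (Real.sqrt_nonneg _) hε
  have t2 : ‖vtx₃ c f (g' - g) h'‖ ≤ cnorm₃ c * (B * (A * ε)) := by
    refine (norm_vtx₃_le_left c _ _ _ hB hfsup).trans (mul_le_mul_of_nonneg_left (mul_le_mul_of_nonneg_left ?_ hB) hc)
    rw [mul_comm A ε]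
    exact mul_le_mul (sqrt_nsq_le_of_sq hε hdg) (sqrt_nsq_le_of_sq hA hh') (Real.sqrt_nonneg _) hε
  have t3 : ‖vtx₃ c f g (h' - h)‖ ≤ cnorm₃ c * (B * (A * ε)) := by
    refine (norm_vtx₃_le_left c _ _ _ hB hfsup).trans (mul_le_mul_of_nonneg_left (mul_le_mul_of_nonneg_left ?_ hB) hc)
    exact mul_le_mul (sqrt_nsq_le_of_sq hA hg) (sqrt_nsq_le_of_sq hε hdh) (Real.sqrt_nonneg _) hA
  calc _ ≤ ‖vtx₃ c (f' - f) g' h' + vtx₃ c f (g' - g) h'‖ + ‖vtx₃ c f g (h' - h)‖ := norm_add_le _ _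
    _ ≤ ‖vtx₃ c (f' - f) g' h'‖ + ‖vtx₃ c f (g' - g) h'‖ + ‖vtx₃ c f g (h' - h)‖ := by
        gcongr; exact norm_add_le _ _
    _ ≤ cnorm₃ c * (B * (A * ε)) + cnorm₃ c * (B * (A * ε)) + cnorm₃ c * (B * (A * ε)) := add_le_add (add_le_add t1 t2) t3
    _ = 3 * (cnorm₃ c * (B * (A * ε))) := by ring

end Vertex

/-! ## §3 Fibre-constant transport (the counting identity behind the exact transport of local vertices under the staircase) -/

section Transport

variable {α α' β : Type*} [Fintype α] [Fintype α'] [Fintype β]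

/-- **FIBRE-CONSTANT TRANSPORT**: along an equivalence `e : α′ ≃ α × β` («fine site ↦ (block parent, offset)»),
`Σ_{x′} F((e x′).1) = |β|·Σ_x F(x)`. [folklore] -/
theorem sum_comp_fst_equiv (e : α' ≃ α × β) (F : α → ℂ) :
    ∑ x', F (e x').1 = (Fintype.card β : ℂ) * ∑ x, F x := by
  have h1 : ∑ x', F (e x').1 = ∑ p : α × β, F p.1 := by
    rw [← e.symm.sum_comp (fun x' => F (e x').1)]
    simp only [Equiv.apply_symm_apply]
  rw [h1, Fintype.sum_prod_type, Finset.mul_sum]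
  refine Finset.sum_congr rfl fun x _ => ?_
  show ∑ _y : β, F x = _
  rw [Finset.sum_const, Finset.card_univ, nsmul_eq_mul]

/-- the same with a second (component) index carried along: `Σ_{x′} F((e x′).1, i) = |β|·Σ_x F(x, i)` summed inside any outer sum is
the special case `F := fun x => G (x, i)`; recorded for the product-index fields of §1. [folklore] -/
theorem sum_comp_fst_equiv_prod {κ : Type*} [Fintype κ] (e : α' ≃ α × β) (G : α × κ → ℂ) :
    ∑ x', ∑ i : κ, G ((e x').1, i) = (Fintype.card β : ℂ) * ∑ x, ∑ i : κ, G (x, i) :=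
  sum_comp_fst_equiv e (fun x => ∑ i : κ, G (x, i))

end Transport

/-! ## §4 Operator-slot entries: rectangular `ℓ²` tools, the entry bound and its Leibniz form -/

section Entry

variable {m k o : Type*} [Fintype m] [Fintype k] [Fintype o] [DecidableEq k] [DecidableEq o]

/-- **`nsq (A v) ≤ ‖A‖²·nsq v` for a RECTANGULAR matrix** (`Matrix.l2_opNorm_def` + `ContinuousLinearMap.le_opNorm`; the square case is
`B5Prop11Lower.nsq_mulVec_le`). [folklore] -/
theorem nsq_mulVec_le_rect (A : Matrix m k ℂ) (v : k → ℂ) : nsq (A *ᵥ v) ≤ ‖A‖ ^ 2 * nsq v := by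
  let x : EuclideanSpace ℂ k := WithLp.toLp 2 v
  let T := ((Matrix.toEuclideanLin (𝕜 := ℂ) (m := m) (n := k)).trans LinearMap.toContinuousLinearMap) A
  have h : ‖T x‖ ≤ ‖T‖ * ‖x‖ := T.le_opNorm x
  have e1 : ‖T x‖ ^ 2 = nsq (A *ᵥ v) := by
    rw [EuclideanSpace.norm_sq_eq]; rfl
  have e2 : ‖x‖ ^ 2 = nsq v := by
    rw [EuclideanSpace.norm_sq_eq]; rfl
  have e3 : ‖T‖ = ‖A‖ := rfl
  rw [← e1, ← e2, ← e3, ← mul_pow]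
  exact pow_le_pow_left₀ (norm_nonneg _) h 2

/-- `nsq (e_q) = 1` for the unit coordinate vector. [folklore] -/
theorem nsq_single_one (q : k) : nsq (Pi.single q (1 : ℂ)) = 1 := by
  rw [nsq, Finset.sum_eq_single q]
  · simp
  · intro b _ hb; simp [hb]
  · intro h; exact (h (Finset.mem_univ q)).elim

/-- **a column of `A` has `ℓ²` size at most `‖A‖`**: `nsq (A.col q) ≤ ‖A‖²` (`A.col q = A e_q`). [folklore] -/
theorem nsq_col_le (A : Matrix m k ℂ) (q : k) : nsq (A.col q) ≤ ‖A‖ ^ 2 := by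
  have h := nsq_mulVec_le_rect A (Pi.single q 1)
  rwa [Matrix.mulVec_single_one, nsq_single_one, mul_one] at h

/-- **THE OPERATOR-SLOT ENTRY BOUND** `‖f*·(T g)‖ ≤ ‖T‖·(√(nsq f)·√(nsq g))` (rectangular `T`). [folklore] -/
theorem norm_entry_le (f : m → ℂ) (T : Matrix m k ℂ) (g : k → ℂ) :
    ‖star f ⬝ᵥ (T *ᵥ g)‖ ≤ ‖T‖ * (Real.sqrt (nsq f) * Real.sqrt (nsq g)) := by
  have h1 := norm_star_dotProduct_le f (T *ᵥ g)
  have h2 : Real.sqrt (nsq (T *ᵥ g)) ≤ ‖T‖ * Real.sqrt (nsq g) := by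
    calc Real.sqrt (nsq (T *ᵥ g)) ≤ Real.sqrt (‖T‖ ^ 2 * nsq g) := Real.sqrt_le_sqrt (nsq_mulVec_le_rect T g)
      _ = ‖T‖ * Real.sqrt (nsq g) := by rw [Real.sqrt_mul (sq_nonneg _), Real.sqrt_sq (norm_nonneg _)]
  calc ‖star f ⬝ᵥ (T *ᵥ g)‖ ≤ Real.sqrt (nsq f) * Real.sqrt (nsq (T *ᵥ g)) := h1
    _ ≤ Real.sqrt (nsq f) * (‖T‖ * Real.sqrt (nsq g)) := mul_le_mul_of_nonneg_left h2 (Real.sqrt_nonneg _)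
    _ = ‖T‖ * (Real.sqrt (nsq f) * Real.sqrt (nsq g)) := by ring

omit [DecidableEq k] in
/-- **LEIBNIZ for an operator-slot entry (exact)**:
`f′*·(T′g′) − f*·(Tg) = (f′−f)*·(T′g′) + f*·((T′−T)g′) + f*·(T(g′−g))`. [folklore] -/
theorem entry_leibniz (f f' : m → ℂ) (T T' : Matrix m k ℂ) (g g' : k → ℂ) :
    star f' ⬝ᵥ (T' *ᵥ g') - star f ⬝ᵥ (T *ᵥ g)
      = star (f' - f) ⬝ᵥ (T' *ᵥ g') + star f ⬝ᵥ ((T' - T) *ᵥ g') + star f ⬝ᵥ (T *ᵥ (g' - g)) := by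
  rw [star_sub, sub_dotProduct, Matrix.sub_mulVec, dotProduct_sub, Matrix.mulVec_sub, dotProduct_sub]
  ring

/-- **R7-S4 FOR AN OPERATOR-SLOT ENTRY**: legs differenced in `ℓ²` (`≤ ε`), the operator slot differenced in OPERATOR norm (`≤ εT`),
undifferenced legs `ℓ² ≤ A`, undifferenced operators `≤ NT` ⟹ `‖f′*T′g′ − f*Tg‖ ≤ 2·NT·A·ε + A²·εT`. [folklore] -/
theorem norm_entry_sub_entry_le (f f' : m → ℂ) (T T' : Matrix m k ℂ) (g g' : k → ℂ) {ε εT A NT : ℝ} (hε : 0 ≤ ε)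
    (hA : 0 ≤ A) (hNT : 0 ≤ NT)
    (hdf : nsq (f' - f) ≤ ε ^ 2) (hdg : nsq (g' - g) ≤ ε ^ 2) (hdT : ‖T' - T‖ ≤ εT)
    (hf : nsq f ≤ A ^ 2) (hg' : nsq g' ≤ A ^ 2) (hT : ‖T‖ ≤ NT) (hT' : ‖T'‖ ≤ NT) :
    ‖star f' ⬝ᵥ (T' *ᵥ g') - star f ⬝ᵥ (T *ᵥ g)‖ ≤ 2 * (NT * (A * ε)) + A * A * εT := by
  rw [entry_leibniz]
  have t1 : ‖star (f' - f) ⬝ᵥ (T' *ᵥ g')‖ ≤ NT * (A * ε) := by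
    refine (norm_entry_le _ _ _).trans (mul_le_mul hT' ?_ (by positivity) hNT)
    rw [mul_comm A ε]
    exact mul_le_mul (sqrt_nsq_le_of_sq hε hdf) (sqrt_nsq_le_of_sq hA hg') (Real.sqrt_nonneg _) hε
  have t2 : ‖star f ⬝ᵥ ((T' - T) *ᵥ g')‖ ≤ A * A * εT := by
    refine (norm_entry_le _ _ _).trans ?_
    have hεT : 0 ≤ εT := (norm_nonneg _).trans hdT
    calc ‖T' - T‖ * (Real.sqrt (nsq f) * Real.sqrt (nsq g')) ≤ εT * (A * A) :=
          mul_le_mul hdT (mul_le_mul (sqrt_nsq_le_of_sq hA hf) (sqrt_nsq_le_of_sq hA hg') (Real.sqrt_nonneg _) hA)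
            (by positivity) hεT
      _ = A * A * εT := by ring
  have t3 : ‖star f ⬝ᵥ (T *ᵥ (g' - g))‖ ≤ NT * (A * ε) := by
    refine (norm_entry_le _ _ _).trans (mul_le_mul hT ?_ (by positivity) hNT)
    exact mul_le_mul (sqrt_nsq_le_of_sq hA hf) (sqrt_nsq_le_of_sq hε hdg) (Real.sqrt_nonneg _) hA
  calc _ ≤ ‖star (f' - f) ⬝ᵥ (T' *ᵥ g') + star f ⬝ᵥ ((T' - T) *ᵥ g')‖ + ‖star f ⬝ᵥ (T *ᵥ (g' - g))‖ := norm_add_le _ _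
    _ ≤ ‖star (f' - f) ⬝ᵥ (T' *ᵥ g')‖ + ‖star f ⬝ᵥ ((T' - T) *ᵥ g')‖ + ‖star f ⬝ᵥ (T *ᵥ (g' - g))‖ := by
        gcongr; exact norm_add_le _ _
    _ ≤ NT * (A * ε) + A * A * εT + NT * (A * ε) := add_le_add (add_le_add t1 t2) t3
    _ = 2 * (NT * (A * ε)) + A * A * εT := by ring

/-- **GRAM-KERNEL ENTRIES**: `‖(Aᴴ·B) p r‖ ≤ ‖A‖·‖B‖` for rectangular `A : Matrix m k ℂ`, `B : Matrix m o ℂ` — the unit-lattice pairing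
`⟨A e_p, B e_r⟩` of two columns is bounded by the operator norms. [folklore] -/
theorem norm_conjTranspose_mul_apply_le (A : Matrix m k ℂ) (B : Matrix m o ℂ) (p : k) (r : o) :
    ‖(Aᴴ * B) p r‖ ≤ ‖A‖ * ‖B‖ := by
  have e : (Aᴴ * B) p r = star (A.col p) ⬝ᵥ (B *ᵥ Pi.single r 1) := by
    rw [Matrix.mulVec_single_one, Matrix.mul_apply, dotProduct]
    refine Finset.sum_congr rfl fun x _ => ?_
    rw [Matrix.conjTranspose_apply]; rfl
  rw [e]
  refine (norm_entry_le _ _ _).trans ?_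
  rw [nsq_single_one, Real.sqrt_one, mul_one]
  calc ‖B‖ * Real.sqrt (nsq (A.col p)) ≤ ‖B‖ * ‖A‖ :=
        mul_le_mul_of_nonneg_left (sqrt_nsq_le_of_sq (norm_nonneg _) (nsq_col_le A p)) (norm_nonneg _)
    _ = ‖A‖ * ‖B‖ := mul_comm _ _

end Entry

end Summit.QuantumFields.BalabanUV.Beta.GAN24.ChainLeibniz

end
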